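import Summits.AtomisticToContinuum.HydrodynamicLimit.Theorems.ImplosionDichotomyPolynomialCompressionLevel1Forcing

/-!
# Level-2 forcing of the shadowing estimate: `P_V(∂ₘ∂ₗ δV) = ∂ₘ(∂ₗ f − C_l) − C_m(V; ∂(∂ₗδV))`

Helper file for the line `log-lipschitz-budget` of the crux `ImplosionDichotomy.PolynomialCompression`
(stmt-AtomisticToContinuum-12587), stub `stub_logBudgetShadowing`, blueprint §4 (level 2): the one-step
commutator `hsEuler_frozen_commutator_*` applied to the level-1 field `W¹ = ∂ₗ δV`, whose frozen image
`P_V W¹` is known from `hsEuler_level1_forcing_*` as a function on the torus.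
-/

noncomputable section

namespace Summit.AtomisticToContinuum.HydrodynamicLimit.Theorems

open Set Filter Topology MeasureTheory
open scoped ContDiff
open Literature.MathematicalPhysics.KineticTheory Literature.Analysis.FunctionSpaces

/-- **Level-2 forcing, density component.** [folklore] -/
theorem hsEuler_level2_forcing_density :
    ∀ {σ σ' T : ℝ} {ρ θ ρ' θ' : ℝ → T3 → ℝ} {u u' : ℝ → T3 → V3},
      IsHardSphereEulerSolution σ T ρ u θ → IsHardSphereEulerSolution σ' T ρ' u' θ' →
      ∀ {t : ℝ}, t ∈ Ico 0 T → ∀ (x : T3) (l m : Fin 3),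
        Torus.timeDerivWithin (Ico 0 T)
              (fun s => Torus.partialDeriv m (Torus.partialDeriv l (fun y => ρ s y - ρ' s y))) t x +
            ∑ i, u t x i * Torus.partialDeriv i
              (Torus.partialDeriv m (Torus.partialDeriv l (fun y => ρ t y - ρ' t y))) x +
            ρ t x * ∑ i, Torus.partialDeriv i
              (fun y => Torus.partialDeriv m (Torus.partialDeriv l (fun z => u t z - u' t z)) y i) x =
          Torus.partialDeriv m (fun y₁ =>
              Torus.partialDeriv l (fun y =>
                  -((ρ t y - ρ' t y) * ∑ i, Torus.partialDeriv i (fun z => u' t z i) y) -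
                    ∑ i, (u t y i - u' t y i) * Torus.partialDeriv i (ρ' t) y) y₁ -
                (∑ i, Torus.partialDeriv l (fun y => u t y i) y₁ *
                    Torus.partialDeriv i (fun y => ρ t y - ρ' t y) y₁ +
                  Torus.partialDeriv l (ρ t) y₁ *
                    ∑ i, Torus.partialDeriv i (fun y => (u t y - u' t y) i) y₁)) x -
            (∑ i, Torus.partialDeriv m (fun y => u t y i) x *
                Torus.partialDeriv i (Torus.partialDeriv l (fun y => ρ t y - ρ' t y)) x +
              Torus.partialDeriv m (ρ t) x *
                ∑ i, Torus.partialDeriv i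
                  (fun y => Torus.partialDeriv l (fun z => u t z - u' t z) y i) x) := by
  intro σ σ' T ρ θ ρ' θ' u u' hE hE' t ht x l m
  have hα₀ : Torus.IsSmoothSpaceTimeOn (Ico 0 T) (fun s y => ρ s y - ρ' s y) :=
    hE.smooth_density.sub hE'.smooth_density
  have hw₀ : Torus.IsSmoothSpaceTimeOn (Ico 0 T) (fun s y => u s y - u' s y) :=
    hE.smooth_velocity.sub hE'.smooth_velocity
  have hα : Torus.IsSmoothSpaceTimeOn (Ico 0 T)
      (fun s => Torus.partialDeriv l (fun y => ρ s y - ρ' s y)) :=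
    hα₀.partialDeriv (uniqueDiffOn_Ico 0 T) l
  have hw : Torus.IsSmoothSpaceTimeOn (Ico 0 T)
      (fun s => Torus.partialDeriv l (fun y => u s y - u' s y)) :=
    hw₀.partialDeriv (uniqueDiffOn_Ico 0 T) l
  have hJc := hsEuler_frozen_commutator_density
    (α := fun s => Torus.partialDeriv l (fun y => ρ s y - ρ' s y))
    (w := fun s => Torus.partialDeriv l (fun y => u s y - u' s y)) hE hα hw ht x m
  have hfun : (fun y => Torus.timeDerivWithin (Ico 0 T)
          (fun s => Torus.partialDeriv l (fun y => ρ s y - ρ' s y)) t y +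
        ∑ i, u t y i * Torus.partialDeriv i (Torus.partialDeriv l (fun y => ρ t y - ρ' t y)) y +
        ρ t y * ∑ i, Torus.partialDeriv i
          (fun z => Torus.partialDeriv l (fun y => u t y - u' t y) z i) y) =
      fun y₁ => Torus.partialDeriv l (fun y =>
            -((ρ t y - ρ' t y) * ∑ i, Torus.partialDeriv i (fun z => u' t z i) y) -
              ∑ i, (u t y i - u' t y i) * Torus.partialDeriv i (ρ' t) y) y₁ -
          (∑ i, Torus.partialDeriv l (fun y => u t y i) y₁ *
              Torus.partialDeriv i (fun y => ρ t y - ρ' t y) y₁ +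
            Torus.partialDeriv l (ρ t) y₁ *
              ∑ i, Torus.partialDeriv i (fun y => (u t y - u' t y) i) y₁) :=
    funext fun y => hsEuler_level1_forcing_density hE hE' ht y l
  rw [hJc, hfun]

/-- **Level-2 forcing, velocity component** (laws `ζ` for `V`, `ζ₂` for the reference). [folklore] -/
theorem hsEuler_level2_forcing_velocity :
    ∀ {σ σ' T : ℝ} {ρ θ ρ' θ' : ℝ → T3 → ℝ} {u u' : ℝ → T3 → V3} {ζ ζ₂ : ℝ → ℝ} {J J₂ : Set ℝ},
      IsHardSphereEulerSolution σ T ρ u θ → IsHardSphereEulerSolution σ' T ρ' u' θ' → IsOpen J →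
      ContDiffOn ℝ (⊤ : ℕ∞) ζ J → (∀ t ∈ Ico 0 T, ∀ x, ρ t x ∈ J) →
      (∀ t ∈ Ico 0 T, ∀ x, hsPressure σ (ρ t x) (θ t x) = ρ t x * θ t x * ζ (ρ t x)) →
      IsOpen J₂ → ContDiffOn ℝ (⊤ : ℕ∞) ζ₂ J₂ → (∀ t ∈ Ico 0 T, ∀ x, ρ' t x ∈ J₂) →
      (∀ t ∈ Ico 0 T, ∀ x, hsPressure σ' (ρ' t x) (θ' t x) = ρ' t x * θ' t x * ζ₂ (ρ' t x)) →
      ∀ {t : ℝ}, t ∈ Ico 0 T → ∀ (x : T3) (l m j : Fin 3),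
        Torus.timeDerivWithin (Ico 0 T)
              (fun s y => Torus.partialDeriv m
                (Torus.partialDeriv l (fun z => u s z - u' s z)) y j) t x +
            ∑ i, u t x i * Torus.partialDeriv i
              (fun y => Torus.partialDeriv m
                (Torus.partialDeriv l (fun z => u t z - u' t z)) y j) x +
            θ t x * (ζ (ρ t x) + ρ t x * deriv ζ (ρ t x)) / ρ t x *
              Torus.partialDeriv j
                (Torus.partialDeriv m (Torus.partialDeriv l (fun y => ρ t y - ρ' t y))) x +
            ζ (ρ t x) * Torus.partialDeriv j
                (Torus.partialDeriv m (Torus.partialDeriv l (fun y => θ t y - θ' t y))) x =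
          Torus.partialDeriv m (fun y₁ =>
              Torus.partialDeriv l (fun y =>
                  -(∑ i, (u t y i - u' t y i) * Torus.partialDeriv i (fun z => u' t z j) y) -
                    (θ t y * (ζ (ρ t y) + ρ t y * deriv ζ (ρ t y)) / ρ t y -
                        θ' t y * (ζ₂ (ρ' t y) + ρ' t y * deriv ζ₂ (ρ' t y)) / ρ' t y) *
                      Torus.partialDeriv j (ρ' t) y -
                    (ζ (ρ t y) - ζ₂ (ρ' t y)) * Torus.partialDeriv j (θ' t) y) y₁ -
                (∑ i, Torus.partialDeriv l (fun y => u t y i) y₁ *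
                    Torus.partialDeriv i (fun y => (u t y - u' t y) j) y₁ +
                  Torus.partialDeriv l
                      (fun y => θ t y * (ζ (ρ t y) + ρ t y * deriv ζ (ρ t y)) / ρ t y) y₁ *
                    Torus.partialDeriv j (fun y => ρ t y - ρ' t y) y₁ +
                  Torus.partialDeriv l (fun y => ζ (ρ t y)) y₁ *
                    Torus.partialDeriv j (fun y => θ t y - θ' t y) y₁)) x -
            (∑ i, Torus.partialDeriv m (fun y => u t y i) x *
                Torus.partialDeriv i
                  (fun y => Torus.partialDeriv l (fun z => u t z - u' t z) y j) x +
              Torus.partialDeriv m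
                  (fun y => θ t y * (ζ (ρ t y) + ρ t y * deriv ζ (ρ t y)) / ρ t y) x *
                Torus.partialDeriv j (Torus.partialDeriv l (fun y => ρ t y - ρ' t y)) x +
              Torus.partialDeriv m (fun y => ζ (ρ t y)) x *
                Torus.partialDeriv j (Torus.partialDeriv l (fun y => θ t y - θ' t y)) x) := by
  intro σ σ' T ρ θ ρ' θ' u u' ζ ζ₂ J J₂ hE hE' hJ hζ hρJ hp hJ₂ hζ₂ hρJ₂ hp' t ht x l m j
  have hα : Torus.IsSmoothSpaceTimeOn (Ico 0 T)
      (fun s => Torus.partialDeriv l (fun y => ρ s y - ρ' s y)) :=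
    (hE.smooth_density.sub hE'.smooth_density).partialDeriv (uniqueDiffOn_Ico 0 T) l
  have hw : Torus.IsSmoothSpaceTimeOn (Ico 0 T)
      (fun s => Torus.partialDeriv l (fun y => u s y - u' s y)) :=
    (hE.smooth_velocity.sub hE'.smooth_velocity).partialDeriv (uniqueDiffOn_Ico 0 T) l
  have hβ : Torus.IsSmoothSpaceTimeOn (Ico 0 T)
      (fun s => Torus.partialDeriv l (fun y => θ s y - θ' s y)) :=
    (hE.smooth_temperature.sub hE'.smooth_temperature).partialDeriv (uniqueDiffOn_Ico 0 T) l
  have hJc := hsEuler_frozen_commutator_velocity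
    (α := fun s => Torus.partialDeriv l (fun y => ρ s y - ρ' s y))
    (w := fun s => Torus.partialDeriv l (fun y => u s y - u' s y))
    (β := fun s => Torus.partialDeriv l (fun y => θ s y - θ' s y)) hE hJ hζ hρJ hα hw hβ ht x m j
  have hfun : (fun y => Torus.timeDerivWithin (Ico 0 T)
          (fun s z => Torus.partialDeriv l (fun y => u s y - u' s y) z j) t y +
        ∑ i, u t y i * Torus.partialDeriv i
          (fun z => Torus.partialDeriv l (fun y => u t y - u' t y) z j) y +
        θ t y * (ζ (ρ t y) + ρ t y * deriv ζ (ρ t y)) / ρ t y *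
          Torus.partialDeriv j (Torus.partialDeriv l (fun y => ρ t y - ρ' t y)) y +
        ζ (ρ t y) * Torus.partialDeriv j (Torus.partialDeriv l (fun y => θ t y - θ' t y)) y) =
      fun y₁ => Torus.partialDeriv l (fun y =>
            -(∑ i, (u t y i - u' t y i) * Torus.partialDeriv i (fun z => u' t z j) y) -
              (θ t y * (ζ (ρ t y) + ρ t y * deriv ζ (ρ t y)) / ρ t y -
                  θ' t y * (ζ₂ (ρ' t y) + ρ' t y * deriv ζ₂ (ρ' t y)) / ρ' t y) *
                Torus.partialDeriv j (ρ' t) y -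
              (ζ (ρ t y) - ζ₂ (ρ' t y)) * Torus.partialDeriv j (θ' t) y) y₁ -
          (∑ i, Torus.partialDeriv l (fun y => u t y i) y₁ *
              Torus.partialDeriv i (fun y => (u t y - u' t y) j) y₁ +
            Torus.partialDeriv l
                (fun y => θ t y * (ζ (ρ t y) + ρ t y * deriv ζ (ρ t y)) / ρ t y) y₁ *
              Torus.partialDeriv j (fun y => ρ t y - ρ' t y) y₁ +
            Torus.partialDeriv l (fun y => ζ (ρ t y)) y₁ *
              Torus.partialDeriv j (fun y => θ t y - θ' t y) y₁) :=
    funext fun y => hsEuler_level1_forcing_velocity hE hE' hJ hζ hρJ hp hJ₂ hζ₂ hρJ₂ hp' ht y l j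
  rw [hJc, hfun]

/-- **Level-2 forcing, temperature component.** [folklore] -/
theorem hsEuler_level2_forcing_temperature :
    ∀ {σ σ' T : ℝ} {ρ θ ρ' θ' : ℝ → T3 → ℝ} {u u' : ℝ → T3 → V3} {ζ ζ₂ : ℝ → ℝ} {J J₂ : Set ℝ},
      IsHardSphereEulerSolution σ T ρ u θ → IsHardSphereEulerSolution σ' T ρ' u' θ' → IsOpen J →
      ContDiffOn ℝ (⊤ : ℕ∞) ζ J → (∀ t ∈ Ico 0 T, ∀ x, ρ t x ∈ J) →
      (∀ t ∈ Ico 0 T, ∀ x, hsPressure σ (ρ t x) (θ t x) = ρ t x * θ t x * ζ (ρ t x)) →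
      IsOpen J₂ → ContDiffOn ℝ (⊤ : ℕ∞) ζ₂ J₂ → (∀ t ∈ Ico 0 T, ∀ x, ρ' t x ∈ J₂) →
      (∀ t ∈ Ico 0 T, ∀ x, hsPressure σ' (ρ' t x) (θ' t x) = ρ' t x * θ' t x * ζ₂ (ρ' t x)) →
      ∀ {t : ℝ}, t ∈ Ico 0 T → ∀ (x : T3) (l m : Fin 3),
        Torus.timeDerivWithin (Ico 0 T)
              (fun s => Torus.partialDeriv m (Torus.partialDeriv l (fun y => θ s y - θ' s y))) t x +
            ∑ i, u t x i * Torus.partialDeriv i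
              (Torus.partialDeriv m (Torus.partialDeriv l (fun y => θ t y - θ' t y))) x +
            2 / 3 * (θ t x * ζ (ρ t x)) * ∑ i, Torus.partialDeriv i
              (fun y => Torus.partialDeriv m (Torus.partialDeriv l (fun z => u t z - u' t z)) y i) x =
          Torus.partialDeriv m (fun y₁ =>
              Torus.partialDeriv l (fun y =>
                  -(∑ i, (u t y i - u' t y i) * Torus.partialDeriv i (θ' t) y) -
                    2 / 3 * (θ t y * ζ (ρ t y) - θ' t y * ζ₂ (ρ' t y)) *
                      ∑ i, Torus.partialDeriv i (fun z => u' t z i) y) y₁ -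
                (∑ i, Torus.partialDeriv l (fun y => u t y i) y₁ *
                    Torus.partialDeriv i (fun y => θ t y - θ' t y) y₁ +
                  2 / 3 * Torus.partialDeriv l (fun y => θ t y * ζ (ρ t y)) y₁ *
                    ∑ i, Torus.partialDeriv i (fun y => (u t y - u' t y) i) y₁)) x -
            (∑ i, Torus.partialDeriv m (fun y => u t y i) x *
                Torus.partialDeriv i (Torus.partialDeriv l (fun y => θ t y - θ' t y)) x +
              2 / 3 * Torus.partialDeriv m (fun y => θ t y * ζ (ρ t y)) x *
                ∑ i, Torus.partialDeriv i
                  (fun y => Torus.partialDeriv l (fun z => u t z - u' t z) y i) x) := by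
  intro σ σ' T ρ θ ρ' θ' u u' ζ ζ₂ J J₂ hE hE' hJ hζ hρJ hp hJ₂ hζ₂ hρJ₂ hp' t ht x l m
  have hw : Torus.IsSmoothSpaceTimeOn (Ico 0 T)
      (fun s => Torus.partialDeriv l (fun y => u s y - u' s y)) :=
    (hE.smooth_velocity.sub hE'.smooth_velocity).partialDeriv (uniqueDiffOn_Ico 0 T) l
  have hβ : Torus.IsSmoothSpaceTimeOn (Ico 0 T)
      (fun s => Torus.partialDeriv l (fun y => θ s y - θ' s y)) :=
    (hE.smooth_temperature.sub hE'.smooth_temperature).partialDeriv (uniqueDiffOn_Ico 0 T) l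
  have hJc := hsEuler_frozen_commutator_temperature
    (w := fun s => Torus.partialDeriv l (fun y => u s y - u' s y))
    (β := fun s => Torus.partialDeriv l (fun y => θ s y - θ' s y)) hE hζ hρJ hw hβ ht x m
  have hfun : (fun y => Torus.timeDerivWithin (Ico 0 T)
          (fun s => Torus.partialDeriv l (fun y => θ s y - θ' s y)) t y +
        ∑ i, u t y i * Torus.partialDeriv i (Torus.partialDeriv l (fun y => θ t y - θ' t y)) y +
        2 / 3 * (θ t y * ζ (ρ t y)) * ∑ i, Torus.partialDeriv i
          (fun z => Torus.partialDeriv l (fun y => u t y - u' t y) z i) y) =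
      fun y₁ => Torus.partialDeriv l (fun y =>
            -(∑ i, (u t y i - u' t y i) * Torus.partialDeriv i (θ' t) y) -
              2 / 3 * (θ t y * ζ (ρ t y) - θ' t y * ζ₂ (ρ' t y)) *
                ∑ i, Torus.partialDeriv i (fun z => u' t z i) y) y₁ -
          (∑ i, Torus.partialDeriv l (fun y => u t y i) y₁ *
              Torus.partialDeriv i (fun y => θ t y - θ' t y) y₁ +
            2 / 3 * Torus.partialDeriv l (fun y => θ t y * ζ (ρ t y)) y₁ *
              ∑ i, Torus.partialDeriv i (fun y => (u t y - u' t y) i) y₁) :=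
    funext fun y => hsEuler_level1_forcing_temperature hE hE' hJ hζ hρJ hp hJ₂ hζ₂ hρJ₂ hp' ht y l
  rw [hJc, hfun]

end Summit.AtomisticToContinuum.HydrodynamicLimit.Theorems

end
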